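import Summits.QuantumFields.QCD.Theses.SpectralDefectExtinction
import Literature.MathematicalPhysics.QuantumFieldTheory.SpectralDefectDensity
import Literature.MathematicalPhysics.QuantumFieldTheory.QCDPhaseQuenched
import Literature.Barriers.QuantumFields.WilsonDeterminantMassSplitting
import Literature.MathematicalPhysics.QuantumLattice.OverlapLocality
import Summits.QuantumFields.QCD.Theorems.SpectralDefectExtinctionTipNoBindingStubPositivity
import Literature.MathematicalPhysics.QuantumLattice.WilsonFermionBlockAveraging

/-!
# Disproof work file for crux `WegnerEstimate` (item stmt-QuantumFields-8966)

Crux (route `SpectralDefectExtinction`, rank 4; verbatim shared with `WilsonMobilityGap.WegnerEstimate`,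
`Iff.rfl`): `∃ C > 0, p ≥ 0, ∀ β ≥ 1, ∀ L ≥ 2, ∀ m₀ ∈ [-1,0], ∀ ε ∈ (0,1],
E_{Wilson(β,L)} #{eigenvalues of γ₅ D_W(U,m₀,1) in (-ε,ε)} ≤ C (1+β^p) ε L⁴`.

## Findings (cycle 1, refuter-cdisprove-stmt-QuantumFields-8966-0) — NO KILL

* READ-BACK. Elaborates (rc 0). `wilsonDirac ρ U m r` has diagonal `m + 4r` and hops
  `-½[(r-γ_μ)U δ_{y,x+μ̂} + (r+γ_μ)U⁻¹ δ_{x,y+μ̂}]`, so `m₀ = 0` IS the tree-level chiral point and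
  `[-1,0]` the first supercritical band (doublers at `-2,-4,-6,-8`) — as intended.  `β` is the tree's
  `β = β_W/3` (weight `exp(-β Σ_p (3 - Re tr U_p))`), so `β ≥ 1` is `β_W ≥ 3`, i.e. the band includes
  STRONG coupling.  The measure is a genuine probability measure
  (`isProbabilityMeasure_wilsonMeasure_fundamental`); the integrand is bounded by `12 L⁴`
  (`windowCount_le`), so the Bochner integral is the honest expectation whenever the count is
  a.e.-strongly measurable (it is Borel: lower semicontinuous in `U`; not proved here) and `0`
  otherwise — junk can only make the crux EASIER, never false.
* (a) LOAD-BEARING ANALYSIS.  `0 < ε` is load-bearing in the trivial sense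
  (`wegnerEstimate_false_without_epsPos`: at `ε = -1` the left side is `0`, the right side `< 0`).
  `ε ≤ 1` is NOT load-bearing (`wegnerEstimate_iff_allEps`: for `ε ≥ 1` the bound holds with
  `C = 12` because the count is `≤ 12 L⁴`).  All content sits at `ε → 0`
  (`wegnerEstimate_restricted_to_eps_ge`: for every fixed `ε₀ > 0` the crux restricted to
  `ε ≥ ε₀` holds with `C = 12/ε₀`, `p = 0`).  `1 ≤ β`, `2 ≤ L`, `-1 ≤ m₀ ≤ 0`: no break found when
  each is dropped/weakened (`β ∈ [0,1)`: Haar-like links, same heuristics; `L = 1`: the extreme toron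
  case, still polynomial in `β`; `m₀ ∈ (-8,-1)`: doubler corners add multiplicity only; `m₀ = -4` with
  `L` even is the exact sublattice-chiral point `ε(x) H ε(x) = -H` (class AIII random hopping) — the
  one place a Gade-type DOS enhancement could live, OUTSIDE the crux's band; `m₀ > 0` and `m₀ < -8`
  are gapped by Wilson positivity, tree `stub_positivity`).
* (b) TIGHTNESS.  The polynomial factor `(1+β^p)` IS necessary: the `β`-uniform strengthening
  (`WegnerEstimatePZero`, `p = 0`) is false GIVEN the toron floor `ToronFloor`
  (`not_wegnerEstimatePZero_of_toronFloor`, proved): on the fixed `2⁴` torus the pure-gauge Wilson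
  measure concentrates, as `β → ∞`, on torons with holonomy angles `|θ| ≍ β^{-1/4}` (entropy of the
  18 constant off-Cartan modes, `∫ d⁸θ |θ|^{6-18}` divergent at `θ = 0`; Coste–González-Arroyo–
  Korthals-Altes et al. 1985 "zero-momentum contribution", van Baal 1988), equally on the `3⁴`
  centre sectors; in the trivial sector `γ₅D_W(U,0,1)` carries 12 modes at `≈ ±|θ^a|/2`, so
  `E N(ε; m₀ = 0) → 12/81` for `β^{-1/4} ≪ ε ≪ 1` and `sup_ε E N/ε ≍ β^{1/4} → ∞`.  `ToronFloor`
  itself (Laplace asymptotics of the `SU(3)` Wilson measure on `2⁴` at the singular stratum of flat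
  connections) is NOT provable here — recorded as the sorry'd near-miss `toronFloor` with the
  heuristic and the compute evidence (job ids in its docstring).  Consequence for provers: any proof
  of the crux must spend `p ≥ 1/4`; the natural guess is `p = 1/4` from `L = 2`.
* (c) NATURAL STRENGTHENINGS refuted/privileged: `p = 0` (above, modulo `ToronFloor`).  Not refuted:
  `ε^α` with `α < 1` replaced by `α = 1` (the crux) — no degenerate-critical-value mechanism found:
  with `n = 32 L⁴ ≥ 512` Haar dimensions an isolated degenerate critical point of an eigenvalue branch
  at level `0` cannot beat `ε¹` (log-canonical threshold `≥ 1`); only a branch TANGENT to `0` along a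
  hypersurface (`λ = f²`) gives `ε^{1/2}`, and `γ₅`-Hermiticity provides no symmetry forcing that in
  the band `[-1,0]`.
* (c') WILSON-POSITIVITY REDUCTION (proved, `exists_re_form_lt_of_window`,
  `exists_dirichlet_lt_of_window`, `windowCount_eq_zero_of_le_mass`): a window eigenvalue of
  `γ₅D_W(U,m₀,1)` forces a unit colour–spinor field with covariant Dirichlet energy `< ε - m₀`
  (and by min–max `N ≤ 4·#{eig ½Δ_U < ε - m₀}`, not formalised).  So the `m₀ = 0` endpoint of the
  crux is implied by an IDS bound at the bottom of the random covariant Laplacian; for `m₀ < 0` the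
  content is pseudospectral (pseudo-modes inside the Wilson hole) and positivity is silent; for
  `ε ≤ m₀` the window is empty on every configuration.
* (c'') CONVERSE DIRECTION (proved, `countP_pos_of_small_image`, `window_pos_of_small_image`): a
  unit spinor with `‖D_W(U,m₀,1)v‖ < ε` forces `N(ε;U,m₀) ≥ 1` — the entry point for rigorous LOWER
  bounds (toron floor, defect modes); what is still missing for any lower bound on `E N` is the
  measurability of the count in `U` and a small-ball lower bound for the Wilson measure.
* (c''') FREE TORON MODES (proved, `wilsonDirac_one_mulVec_const`, `window_one_pos`): at `U = 1`
  the 12 constant colour–spinors satisfy `D_W(1,m₀,1)v = m₀v`, so `N(ε; 1, m₀) ≥ 1` for every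
  `ε > |m₀|`, every `L`; with gauge invariance and continuity this is the configuration-wise half
  of the toron floor (the measure half — small-ball mass near the pure-gauge orbit — is the sorry).
* (c'''') GAUGE INVARIANCE (proved, `charpoly_hermitianWilsonDirac_gaugeTransform`, `window_pureGauge_pos`):
  the window count is constant on gauge orbits; every pure gauge `1^g` has `N(ε;1^g,m₀) ≥ 1` for
  `ε > |m₀|` — the configuration-wise half of the toron floor on the whole orbit.
* (d) TARGETS: none yet (no line picked; payload.targets empty).
* (e) NEAR-MISSES: `toronFloor` (sorry) — see its docstring.
* NUMERICS (kit jobs j013765 strong-coupling `2⁴`, j013777 toron `2⁴`; `3⁴`/`4⁴` runs j013781/j013785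
  attach to the item when done): strong coupling GAPPED (no `ε^α` anomaly, `C ≈ 0.5`, `p = 0` fit the
  data); toron law `β^{-1/4}` and plateau `12/81` CONFIRMED — numbers in `toronFloor`'s docstring.

Everything below is sorry-free except the near-miss `toronFloor`.  The sorry-free part is LANDED
(importable by provers and planners): `Summits.QuantumFields.QCD.Theorems.WegnerEstimate.Negative.LoadBearing`
(p74148) and `…Negative.PositivityReduction` (p74149), namespace
`Summit.QuantumFields.QCD.Theorems.WegnerEstimateNegative`, statements written out verbatim.
-/

namespace Summit.QuantumFields.QCD.Cruxes.WegnerEstimate.Disproof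

open MeasureTheory
open scoped Matrix
open Literature.MathematicalPhysics.QuantumLattice Literature.MathematicalPhysics.QuantumFieldTheory
  Literature.Probability.LatticeModels
open Summit.QuantumFields.QCD.Theses.SpectralDefectExtinction (WegnerEstimate)
open Literature.Barriers.QuantumFields (wilsonDirac_add_mass isHermitian_gammaFive_mul_wilsonDirac)
open Matrix

noncomputable section

/-! ## The objects of the crux -/

/-- `N(ε; U, m₀)`: number of eigenvalues (roots of the characteristic polynomial, with multiplicity)
of the Hermitian Wilson–Dirac operator `γ₅ D_W(U, m₀, 1)` with `|Re z| < ε` — verbatim the crux's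
integrand. -/
def windowCount {L : ℕ} [NeZero L] (U : GaugeConfig 4 L SU3) (m₀ ε : ℝ) : ℕ :=
  Multiset.countP (fun z : ℂ => |z.re| < ε)
    (spinorLift gammaFive * wilsonDirac (fundamentalRep (Fin 3)) U m₀ 1).charpoly.roots

/-- `E_{β,L} N(ε; ·, m₀)`: its Wilson-measure expectation (Bochner integral) — verbatim the crux's
left-hand side. -/
def expWindowCount (β : ℝ) (L : ℕ) [NeZero L] (m₀ ε : ℝ) : ℝ :=
  ∫ U, (windowCount U m₀ ε : ℝ) ∂(wilsonMeasure (d := 4) (L := L) (fundamentalRep (Fin 3)) β)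

/-- The crux, restated through `expWindowCount` (definitional). -/
theorem wegnerEstimate_iff :
    WegnerEstimate ↔ ∃ C p : ℝ, 0 < C ∧ 0 ≤ p ∧ ∀ β : ℝ, 1 ≤ β → ∀ (L : ℕ) [NeZero L], 2 ≤ L →
      ∀ m₀ ε : ℝ, -1 ≤ m₀ → m₀ ≤ 0 → 0 < ε → ε ≤ 1 →
        expWindowCount β L m₀ ε ≤ C * (1 + β ^ p) * ε * (L : ℝ) ^ 4 :=
  Iff.rfl

/-! ## Elementary bounds: the count is at most the dimension `12 L⁴` -/

theorem windowCount_le {L : ℕ} [NeZero L] (U : GaugeConfig 4 L SU3) (m₀ ε : ℝ) :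
    windowCount U m₀ ε ≤ 12 * L ^ 4 := by
  unfold windowCount
  calc Multiset.countP (fun z : ℂ => |z.re| < ε)
        (spinorLift gammaFive * wilsonDirac (fundamentalRep (Fin 3)) U m₀ 1).charpoly.roots
      ≤ Multiset.card
          (spinorLift gammaFive * wilsonDirac (fundamentalRep (Fin 3)) U m₀ 1).charpoly.roots :=
        Multiset.countP_le_card _ _
    _ ≤ (spinorLift gammaFive * wilsonDirac (fundamentalRep (Fin 3)) U m₀ 1).charpoly.natDegree :=
        Polynomial.card_roots' _
    _ = Fintype.card (QuarkIdx L) := Matrix.charpoly_natDegree_eq_dim _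
    _ = 12 * L ^ 4 := card_quarkIdx

theorem windowCount_cast_le {L : ℕ} [NeZero L] (U : GaugeConfig 4 L SU3) (m₀ ε : ℝ) :
    (windowCount U m₀ ε : ℝ) ≤ 12 * (L : ℝ) ^ 4 := by
  exact_mod_cast windowCount_le U m₀ ε

/-- If the window is empty on the real axis (`ε ≤ 0`) the count vanishes. -/
theorem windowCount_eq_zero_of_nonpos {L : ℕ} [NeZero L] (U : GaugeConfig 4 L SU3) (m₀ : ℝ)
    {ε : ℝ} (hε : ε ≤ 0) : windowCount U m₀ ε = 0 := by
  unfold windowCount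
  rw [Multiset.countP_eq_zero]
  intro z _ hz
  exact absurd (lt_of_lt_of_le hz hε) (not_lt.2 (abs_nonneg z.re))

theorem expWindowCount_nonneg (β : ℝ) (L : ℕ) [NeZero L] (m₀ ε : ℝ) :
    0 ≤ expWindowCount β L m₀ ε :=
  integral_nonneg fun _ => Nat.cast_nonneg _

/-- `E N ≤ 12 L⁴` — whether or not the count is integrable (a non-integrable integrand has Bochner
integral `0`). -/
theorem expWindowCount_le (β : ℝ) (L : ℕ) [NeZero L] (m₀ ε : ℝ) :
    expWindowCount β L m₀ ε ≤ 12 * (L : ℝ) ^ 4 := by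
  unfold expWindowCount
  have hconst : ∫ _U, (12 * (L : ℝ) ^ 4 : ℝ)
      ∂(wilsonMeasure (d := 4) (L := L) (fundamentalRep (Fin 3)) β) = 12 * (L : ℝ) ^ 4 := by
    simp [integral_const]
  rw [← hconst]
  exact integral_mono_of_nonneg (Filter.Eventually.of_forall fun U => Nat.cast_nonneg _)
    (integrable_const _) (Filter.Eventually.of_forall fun U => windowCount_cast_le U m₀ ε)

theorem expWindowCount_eq_zero_of_nonpos (β : ℝ) (L : ℕ) [NeZero L] (m₀ : ℝ) {ε : ℝ}
    (hε : ε ≤ 0) : expWindowCount β L m₀ ε = 0 := by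
  unfold expWindowCount
  simp [windowCount_eq_zero_of_nonpos _ _ hε]

/-! ## (a) Load-bearing analysis -/

/-- The crux with the hypothesis `0 < ε` DROPPED. -/
def WegnerEstimateWithoutEpsPos : Prop :=
  ∃ C p : ℝ, 0 < C ∧ 0 ≤ p ∧ ∀ β : ℝ, 1 ≤ β → ∀ (L : ℕ) [NeZero L], 2 ≤ L →
    ∀ m₀ ε : ℝ, -1 ≤ m₀ → m₀ ≤ 0 → ε ≤ 1 →
      expWindowCount β L m₀ ε ≤ C * (1 + β ^ p) * ε * (L : ℝ) ^ 4

/-- `0 < ε` is load-bearing (trivially): at `ε = -1` the expectation is `0` while the proposed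
bound is negative.  Witness `β = 1`, `L = 2`, `m₀ = 0`, `ε = -1`. -/
theorem wegnerEstimate_false_without_epsPos : ¬ WegnerEstimateWithoutEpsPos := by
  rintro ⟨C, p, hC, -, h⟩
  have h1 := h 1 le_rfl 2 le_rfl 0 (-1) (by norm_num) le_rfl (by norm_num)
  rw [expWindowCount_eq_zero_of_nonpos 1 2 0 (by norm_num), Real.one_rpow] at h1
  norm_num at h1
  linarith

/-- The crux with the hypothesis `ε ≤ 1` DROPPED. -/
def WegnerEstimateAllEps : Prop :=
  ∃ C p : ℝ, 0 < C ∧ 0 ≤ p ∧ ∀ β : ℝ, 1 ≤ β → ∀ (L : ℕ) [NeZero L], 2 ≤ L →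
    ∀ m₀ ε : ℝ, -1 ≤ m₀ → m₀ ≤ 0 → 0 < ε →
      expWindowCount β L m₀ ε ≤ C * (1 + β ^ p) * ε * (L : ℝ) ^ 4

/-- `ε ≤ 1` is NOT load-bearing: for `ε ≥ 1` the bound holds with `C = 12` since `N ≤ 12 L⁴`. -/
theorem wegnerEstimate_iff_allEps : WegnerEstimate ↔ WegnerEstimateAllEps := by
  rw [wegnerEstimate_iff]
  constructor
  · rintro ⟨C, p, hC, hp, h⟩
    refine ⟨max C 12, p, lt_max_of_lt_left hC, hp, fun β hβ L _ hL m₀ ε hm hm' hε => ?_⟩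
    have hβp : (1 : ℝ) ≤ 1 + β ^ p := le_add_of_nonneg_right (Real.rpow_nonneg (by linarith) p)
    have hL4 : (0 : ℝ) ≤ (L : ℝ) ^ 4 := by positivity
    have hfac : (0 : ℝ) ≤ (1 + β ^ p) * ε * (L : ℝ) ^ 4 :=
      mul_nonneg (mul_nonneg (by linarith) hε.le) hL4
    by_cases h1 : ε ≤ 1
    · calc expWindowCount β L m₀ ε ≤ C * (1 + β ^ p) * ε * (L : ℝ) ^ 4 :=
            h β hβ L hL m₀ ε hm hm' hε h1
        _ = C * ((1 + β ^ p) * ε * (L : ℝ) ^ 4) := by ring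
        _ ≤ max C 12 * ((1 + β ^ p) * ε * (L : ℝ) ^ 4) :=
            mul_le_mul_of_nonneg_right (le_max_left _ _) hfac
        _ = max C 12 * (1 + β ^ p) * ε * (L : ℝ) ^ 4 := by ring
    · have h1' : 1 ≤ ε := (not_le.mp h1).le
      have hab : 12 ≤ max C 12 * (1 + β ^ p) := by
        nlinarith [le_max_right C 12, mul_nonneg (sub_nonneg.2 (le_max_right C 12)) (sub_nonneg.2 hβp)]
      have habe : 12 ≤ max C 12 * (1 + β ^ p) * ε := by
        nlinarith [mul_nonneg (sub_nonneg.2 hab) (sub_nonneg.2 h1')]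
      calc expWindowCount β L m₀ ε ≤ 12 * (L : ℝ) ^ 4 := expWindowCount_le β L m₀ ε
        _ ≤ max C 12 * (1 + β ^ p) * ε * (L : ℝ) ^ 4 := mul_le_mul_of_nonneg_right habe hL4
  · rintro ⟨C, p, hC, hp, h⟩
    exact ⟨C, p, hC, hp, fun β hβ L _ hL m₀ ε hm hm' hε _ => h β hβ L hL m₀ ε hm hm' hε⟩

/-- All content of the crux sits at `ε → 0`: restricted to windows `ε ≥ ε₀` it holds with
`C = 12/ε₀`, `p = 0`, for ANY `β`, `L`, `m₀` (the count is `≤ 12 L⁴ ≤ (12/ε₀) ε L⁴`). -/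
theorem wegnerEstimate_restricted_to_eps_ge {ε₀ : ℝ} (hε₀ : 0 < ε₀) :
    ∀ β : ℝ, ∀ (L : ℕ) [NeZero L], ∀ m₀ ε : ℝ, ε₀ ≤ ε →
      expWindowCount β L m₀ ε ≤ 12 / ε₀ * (1 + β ^ (0 : ℝ)) * ε * (L : ℝ) ^ 4 := by
  intro β L _ m₀ ε hε
  have hL4 : (0 : ℝ) ≤ (L : ℝ) ^ 4 := by positivity
  calc expWindowCount β L m₀ ε ≤ 12 * (L : ℝ) ^ 4 := expWindowCount_le β L m₀ ε
    _ = 12 / ε₀ * ε₀ * (L : ℝ) ^ 4 := by field_simp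
    _ ≤ 12 / ε₀ * (1 + β ^ (0 : ℝ)) * ε * (L : ℝ) ^ 4 := by
      rw [Real.rpow_zero]
      have h12 : (0 : ℝ) ≤ 12 / ε₀ := by positivity
      have : 12 / ε₀ * ε₀ ≤ 12 / ε₀ * (1 + 1) * ε := by nlinarith
      exact mul_le_mul_of_nonneg_right this hL4

/-! ## Structure lemmas for provers (the count is a singular-value count; mass enters as `m₀ Γ₅`) -/

/-- **`(Γ₅ D)² = Dᴴ D`.**  Hence `N(ε; U, m₀)` is the number of SINGULAR VALUES of the non-normal
Wilson–Dirac operator `D_W(U, m₀, 1)` below `ε` (the eigenvalues of the Hermitian `Γ₅ D` squared are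
the eigenvalues of `DᴴD`): the crux is an anti-concentration / Wegner estimate for the small
singular values of `D_W(U,0,1) + m₀`, uniformly in the real shift `m₀ ∈ [-1,0]` — a pseudospectral
statement, NOT a statement about the real eigenvalues of `D_W` alone. -/
theorem hermitianWilsonDirac_mul_self {L : ℕ} [NeZero L] (U : GaugeConfig 4 L SU3) (m₀ : ℝ) :
    (spinorLift gammaFive * wilsonDirac (fundamentalRep (Fin 3)) U m₀ 1) *
        (spinorLift gammaFive * wilsonDirac (fundamentalRep (Fin 3)) U m₀ 1) =
      (wilsonDirac (fundamentalRep (Fin 3)) U m₀ 1)ᴴ * wilsonDirac (fundamentalRep (Fin 3)) U m₀ 1 := by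
  have hρ : ∀ g, fundamentalRep (Fin 3) g ∈ Matrix.unitaryGroup (Fin 3) ℂ :=
    fundamentalRep_mem_unitaryGroup
  rw [← wilsonDirac_gammaFive_hermitian_holds (fundamentalRep (Fin 3)) hρ U m₀ 1]
  simp only [Matrix.mul_assoc]

/-- **Mass shift**: `Γ₅ D_W(U, m₀, 1) = Γ₅ D_W(U, 0, 1) + m₀ Γ₅` — the bare mass is a rank-full,
norm-`|m₀|`, NON-sign-definite perturbation of the Hermitian operator (no spectral monotonicity in
`m₀`; eigenvalue branches move with slopes `⟨ψ, Γ₅ ψ⟩ ∈ [-1, 1]`, the chirality). -/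
theorem hermitianWilsonDirac_mass_shift {L : ℕ} [NeZero L] (U : GaugeConfig 4 L SU3) (m₀ : ℝ) :
    spinorLift gammaFive * wilsonDirac (fundamentalRep (Fin 3)) U m₀ 1 =
      spinorLift gammaFive * wilsonDirac (fundamentalRep (Fin 3)) U 0 1 +
        (m₀ : ℂ) • spinorLift gammaFive := by
  have h := wilsonDirac_add_mass (fundamentalRep (Fin 3)) U 0 m₀ 1
  rw [zero_add] at h
  rw [h, Matrix.mul_add, Matrix.mul_smul, Matrix.mul_one]

/-- The count is monotone in the window. -/
theorem windowCount_mono {L : ℕ} [NeZero L] (U : GaugeConfig 4 L SU3) (m₀ : ℝ) {ε ε' : ℝ}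
    (h : ε ≤ ε') : windowCount U m₀ ε ≤ windowCount U m₀ ε' := by
  unfold windowCount
  simp only [Multiset.countP_eq_card_filter]
  exact Multiset.card_le_card
    (Multiset.monotone_filter_right _ fun z (hz : |z.re| < ε) => lt_of_lt_of_le hz h)

/-- **Hölder fallback** (information for planners): the variant with `ε^α`, `0 < α ≤ 1`, in place of
`ε`.  The route's pricing uses the bound at `ε = c a_k m/Z_k`; an exponent `α < 1` changes the
extinction exponent from `(3 - N_f)/(4b₀) - s_d` to `(2 + α - N_f)/(4b₀) - s_d`, i.e. costs a margin
`(1-α)/(4b₀)` only — so `WegnerEstimateHolder α` for all `α < 1` is an admissible REPAIR target if the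
linear estimate resists (non-monotone Wegner estimates in print are typically Hölder). -/
def WegnerEstimateHolder (α : ℝ) : Prop :=
  ∃ C p : ℝ, 0 < C ∧ 0 ≤ p ∧ ∀ β : ℝ, 1 ≤ β → ∀ (L : ℕ) [NeZero L], 2 ≤ L →
    ∀ m₀ ε : ℝ, -1 ≤ m₀ → m₀ ≤ 0 → 0 < ε → ε ≤ 1 →
      expWindowCount β L m₀ ε ≤ C * (1 + β ^ p) * ε ^ α * (L : ℝ) ^ 4

/-- The crux implies every Hölder variant with `α ≤ 1` (`ε ≤ ε^α` on `(0,1]`). -/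
theorem wegnerEstimateHolder_of_wegnerEstimate (h : WegnerEstimate) {α : ℝ} (hα1 : α ≤ 1) :
    WegnerEstimateHolder α := by
  obtain ⟨C, p, hC, hp, h⟩ := h
  refine ⟨C, p, hC, hp, fun β hβ L _ hL m₀ ε hm hm' hε hε1 => ?_⟩
  have hεα : ε ≤ ε ^ α := by
    calc ε = ε ^ (1 : ℝ) := (Real.rpow_one ε).symm
      _ ≤ ε ^ α := Real.rpow_le_rpow_of_exponent_ge hε hε1 hα1
  have hfac : 0 ≤ C * (1 + β ^ p) :=
    mul_nonneg hC.le (by linarith [Real.rpow_nonneg (show (0:ℝ) ≤ β by linarith) p])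
  have hL4 : (0 : ℝ) ≤ (L : ℝ) ^ 4 := by positivity
  calc expWindowCount β L m₀ ε ≤ C * (1 + β ^ p) * ε * (L : ℝ) ^ 4 := h β hβ L hL m₀ ε hm hm' hε hε1
    _ ≤ C * (1 + β ^ p) * ε ^ α * (L : ℝ) ^ 4 := by
      gcongr

/-! ## (c') Wilson-positivity reduction: a window eigenvalue forces a low covariant-Dirichlet vector -/

section Reduction

variable {n : Type*} [Fintype n] [DecidableEq n]

/-- A Hermitian matrix whose characteristic polynomial has a root with `|Re z| < ε` has a unit
eigenvector with eigenvalue `λ`, `|λ| < ε` (spectral theorem, `Matrix.IsHermitian.eigenvectorBasis`).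
[folklore] -/
theorem exists_eigenvector_of_countP_pos {A : Matrix n n ℂ} (hA : A.IsHermitian) {ε : ℝ}
    (h : 0 < A.charpoly.roots.countP (fun z : ℂ => |z.re| < ε)) :
    ∃ (lam : ℝ) (v : n → ℂ), |lam| < ε ∧ (∑ i, ‖v i‖ ^ 2 = 1) ∧ A *ᵥ v = (lam : ℂ) • v := by
  rw [Multiset.countP_pos] at h
  obtain ⟨z, hz, hzε⟩ := h
  rw [hA.roots_charpoly_eq_eigenvalues] at hz
  obtain ⟨i, -, rfl⟩ := Multiset.mem_map.1 hz
  refine ⟨hA.eigenvalues i, ⇑(hA.eigenvectorBasis i), ?_, ?_, ?_⟩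
  · simpa using hzε
  · have h1 : ‖hA.eigenvectorBasis i‖ = 1 := (hA.eigenvectorBasis).orthonormal.1 i
    rw [EuclideanSpace.norm_eq] at h1
    have h2 : ∑ j, ‖(hA.eigenvectorBasis i) j‖ ^ 2 = 1 := by
      have := congrArg (· ^ 2) h1
      simp only [one_pow] at this
      rwa [Real.sq_sqrt (Finset.sum_nonneg fun j _ => by positivity)] at this
    exact h2
  · exact hA.mulVec_eigenvectorBasis i

omit [DecidableEq n] in
/-- `Re⟨v, v⟩ = Σ ‖v i‖²`. [folklore] -/
theorem re_star_dotProduct_self (v : n → ℂ) : (star v ⬝ᵥ v).re = ∑ i, ‖v i‖ ^ 2 := by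
  rw [dotProduct, Complex.re_sum]
  refine Finset.sum_congr rfl fun i _ => ?_
  rw [Pi.star_apply, Complex.star_def, Complex.conj_mul', ← Complex.ofReal_pow, Complex.ofReal_re]

omit [Fintype n] [DecidableEq n] in
/-- `|Re(conj z · s · z)| ≤ ‖z‖²` for a sign `s = ±1`. [folklore] -/
theorem abs_re_conj_mul_sign_mul_le (z s : ℂ) (hs : s = 1 ∨ s = -1) :
    |(star z * (s * z)).re| ≤ ‖z‖ ^ 2 := by
  rcases hs with rfl | rfl
  · rw [one_mul, Complex.star_def, Complex.conj_mul', ← Complex.ofReal_pow, Complex.ofReal_re,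
      abs_of_nonneg (by positivity)]
  · rw [neg_one_mul, mul_neg, Complex.neg_re, abs_neg, Complex.star_def, Complex.conj_mul',
      ← Complex.ofReal_pow, Complex.ofReal_re, abs_of_nonneg (by positivity)]

/-- **Wilson-positivity reduction (configuration-wise).**  If `γ₅ D_W(U, m₀, 1)` has an eigenvalue
in `(-ε, ε)` — i.e. `D_W(U, m₀, 1)` has a singular value `< ε` — then some UNIT spinor `v` has
`Re⟨v, D_W(U,0,1) v⟩ < ε - m₀`.  (From `D v = λ Γ₅ v` for the eigenvector: `Re⟨v,Dv⟩ = λ Re⟨v,Γ₅v⟩ ≤ |λ|`,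
and `D(m₀) = D(0) + m₀`.)  With Wilson positivity `Re⟨v, D_W(U,0,1)v⟩ = ½ Σ_{x,μ} |U(x,μ)v(x+μ̂) - v(x)|²`
(tree `stub_positivity`) this says: a window eigenvalue at bare mass `m₀ ≤ 0` needs a colour–spinor
field whose covariant Dirichlet energy is `< ε + |m₀|`; by min–max (not formalised) even
`N(ε; U, m₀) ≤ 4 · #{eigenvalues of ½Δ_U^colour < ε - m₀}`.  Consequences: (i) the `m₀ = 0` endpoint of
the crux FOLLOWS from an integrated-density-of-states bound at the bottom of the random covariant
Laplacian, `E #{eig ½Δ_U ≤ ε} ≤ C(1+β^p) ε L⁴/4` (Lifshitz-tail territory at strong coupling; torons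
give onset `ε ≍ β^{-1/2}/8` on `2⁴`, so `p ≥ 1/2` on that route); (ii) for `m₀ < 0` the sublevel
`{Dirichlet < |m₀|}` is macroscopic — the content of the crux at negative bare mass is pseudospectral
(landing of defect/pseudo-modes inside the Wilson hole), untouched by positivity. [folklore] -/
theorem exists_re_form_lt_of_window {L : ℕ} [NeZero L] (U : GaugeConfig 4 L SU3) (m₀ ε : ℝ)
    (h : 0 < windowCount U m₀ ε) :
    ∃ v : QuarkIdx L → ℂ, (∑ i, ‖v i‖ ^ 2 = 1) ∧
      (star v ⬝ᵥ (wilsonDirac (fundamentalRep (Fin 3)) U 0 1 *ᵥ v)).re < ε - m₀ := by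
  have hρ : ∀ g, fundamentalRep (Fin 3) g ∈ Matrix.unitaryGroup (Fin 3) ℂ :=
    fundamentalRep_mem_unitaryGroup
  set Γ : Matrix (QuarkIdx L) (QuarkIdx L) ℂ := spinorLift gammaFive with hΓ
  set D : Matrix (QuarkIdx L) (QuarkIdx L) ℂ := wilsonDirac (fundamentalRep (Fin 3)) U m₀ 1 with hD
  have hH : (Γ * D).IsHermitian := isHermitian_gammaFive_mul_wilsonDirac _ hρ U m₀ 1
  obtain ⟨lam, v, hlam, hv1, hv⟩ := exists_eigenvector_of_countP_pos hH (by unfold windowCount at h; exact h)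
  refine ⟨v, hv1, ?_⟩
  have hΓΓ : Γ * Γ = 1 := spinorLift_gammaFive_mul_self
  have hDv : D *ᵥ v = (lam : ℂ) • (Γ *ᵥ v) := by
    calc D *ᵥ v = (Γ * (Γ * D)) *ᵥ v := by rw [← Matrix.mul_assoc, hΓΓ, Matrix.one_mul]
      _ = Γ *ᵥ ((Γ * D) *ᵥ v) := by rw [Matrix.mulVec_mulVec]
      _ = Γ *ᵥ ((lam : ℂ) • v) := by rw [hv]
      _ = (lam : ℂ) • (Γ *ᵥ v) := by rw [Matrix.mulVec_smul]
  -- `|Re⟨v, Γ v⟩| ≤ 1`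
  have hΓform : |(star v ⬝ᵥ (Γ *ᵥ v)).re| ≤ 1 := by
    rw [hΓ, spinorLift_gammaFive_eq_diagonal, dotProduct, Complex.re_sum]
    refine (Finset.abs_sum_le_sum_abs _ _).trans ?_
    refine (Finset.sum_le_sum fun i _ => ?_).trans_eq hv1
    rw [mulVec_diagonal, Pi.star_apply]
    refine abs_re_conj_mul_sign_mul_le (v i) _ ?_
    obtain ⟨x, a, α⟩ := i
    fin_cases α <;> simp
  -- `Re⟨v, D v⟩ < ε`
  have hDform : (star v ⬝ᵥ (D *ᵥ v)).re < ε := by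
    rw [hDv, dotProduct_smul, smul_eq_mul, Complex.re_ofReal_mul]
    calc lam * (star v ⬝ᵥ Γ *ᵥ v).re ≤ |lam * (star v ⬝ᵥ Γ *ᵥ v).re| := le_abs_self _
      _ = |lam| * |(star v ⬝ᵥ Γ *ᵥ v).re| := abs_mul _ _
      _ ≤ |lam| * 1 := mul_le_mul_of_nonneg_left hΓform (abs_nonneg _)
      _ < ε := by rw [mul_one]; exact hlam
  -- `Re⟨v, D v⟩ = Re⟨v, D₀ v⟩ + m₀`
  have hsplit : (star v ⬝ᵥ (D *ᵥ v)).re =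
      (star v ⬝ᵥ (wilsonDirac (fundamentalRep (Fin 3)) U 0 1 *ᵥ v)).re + m₀ := by
    have hadd := wilsonDirac_add_mass (fundamentalRep (Fin 3)) U 0 m₀ 1
    rw [zero_add] at hadd
    rw [hD, hadd, add_mulVec, smul_mulVec, one_mulVec, dotProduct_add, dotProduct_smul,
      smul_eq_mul, Complex.add_re, Complex.re_ofReal_mul, re_star_dotProduct_self, hv1, mul_one]
  linarith

/-- **Dirichlet form version** (with tree `stub_positivity`): a window eigenvalue of
`γ₅ D_W(U,m₀,1)` in `(-ε,ε)` forces a unit colour–spinor field with covariant Dirichlet energy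
`½ Σ_{x,μ,a,α} |Σ_b U(x,μ)_{ab} v(x+μ̂,b,α) - v(x,a,α)|² < ε - m₀`. [folklore] -/
theorem exists_dirichlet_lt_of_window {L : ℕ} [NeZero L] (U : GaugeConfig 4 L SU3) (m₀ ε : ℝ)
    (h : 0 < windowCount U m₀ ε) :
    ∃ v : QuarkIdx L → ℂ, (∑ i, ‖v i‖ ^ 2 = 1) ∧
      (1 / 2) * ∑ x, ∑ μ, ∑ a, ∑ α,
          ‖(∑ b, (U (x, μ) : Matrix (Fin 3) (Fin 3) ℂ) a b *
              v (Site.shift x μ, b, α)) - v (x, a, α)‖ ^ 2 < ε - m₀ := by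
  obtain ⟨v, hv1, hv⟩ := exists_re_form_lt_of_window U m₀ ε h
  refine ⟨v, hv1, ?_⟩
  rwa [Summit.QuantumFields.QCD.Cruxes.TipNoBinding.PositivityNoLeakSpread.stub_positivity L U v]
    at hv

/-- **Positive-mass gap** (why `m₀ ≤ 0` is where the content is): for `ε ≤ m₀` the window is empty
on EVERY configuration — `|spec γ₅ D_W(U,m₀,1)| ≥ m₀` by Wilson positivity. [folklore] -/
theorem windowCount_eq_zero_of_le_mass {L : ℕ} [NeZero L] (U : GaugeConfig 4 L SU3) {m₀ ε : ℝ}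
    (hε : ε ≤ m₀) : windowCount U m₀ ε = 0 := by
  by_contra hne
  obtain ⟨v, -, hv⟩ := exists_dirichlet_lt_of_window U m₀ ε (Nat.pos_of_ne_zero hne)
  have : (0 : ℝ) ≤ (1 / 2) * ∑ x, ∑ μ, ∑ a, ∑ α,
      ‖(∑ b, (U (x, μ) : Matrix (Fin 3) (Fin 3) ℂ) a b *
          v (Site.shift x μ, b, α)) - v (x, a, α)‖ ^ 2 := by positivity
  linarith

end Reduction

/-! ### Converse direction: small image ⇒ window eigenvalue (entry point for lower bounds) -/

section Converse

variable {n : Type*} [Fintype n] [DecidableEq n]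

/-- An isometry preserves the `ℓ²` sum. [folklore] -/
theorem sum_norm_sq_mulVec_of_isometry {A : Matrix n n ℂ} (hA : Aᴴ * A = 1) (w : n → ℂ) :
    ∑ i, ‖(A *ᵥ w) i‖ ^ 2 = ∑ i, ‖w i‖ ^ 2 := by
  rw [← re_star_dotProduct_self, ← re_star_dotProduct_self, star_mulVec, ← dotProduct_mulVec,
    mulVec_mulVec, hA, one_mulVec]

/-- The `ℓ²` sum of `diagonal d *ᵥ w`. [folklore] -/
theorem sum_norm_sq_diagonal_mulVec (d : n → ℂ) (w : n → ℂ) :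
    ∑ i, ‖(diagonal d *ᵥ w) i‖ ^ 2 = ∑ i, ‖d i‖ ^ 2 * ‖w i‖ ^ 2 := by
  refine Finset.sum_congr rfl fun i _ => ?_
  rw [mulVec_diagonal, norm_mul, mul_pow]

/-- A unit vector `v` with `‖A v‖ < ε` forces an eigenvalue of the Hermitian `A` in `(-ε, ε)`
(spectral theorem: `‖Av‖² = Σ_j λ_j² |⟨e_j, v⟩|²`). [folklore] -/
theorem countP_pos_of_small_image {A : Matrix n n ℂ} (hA : A.IsHermitian) {ε : ℝ} (hε : 0 ≤ ε)
    (v : n → ℂ) (hv1 : ∑ i, ‖v i‖ ^ 2 = 1) (hv : ∑ i, ‖(A *ᵥ v) i‖ ^ 2 < ε ^ 2) :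
    0 < A.charpoly.roots.countP (fun z : ℂ => |z.re| < ε) := by
  by_contra h0
  have h0' : A.charpoly.roots.countP (fun z : ℂ => |z.re| < ε) = 0 := by omega
  rw [Multiset.countP_eq_zero] at h0'
  have hlam : ∀ j, ε ≤ |hA.eigenvalues j| := by
    intro j
    have hmem : ((hA.eigenvalues j : ℝ) : ℂ) ∈ A.charpoly.roots := by
      rw [hA.roots_charpoly_eq_eigenvalues]
      exact Multiset.mem_map.2 ⟨j, Finset.mem_univ_val j, rfl⟩
    have := h0' _ hmem
    simpa using this
  set U : Matrix n n ℂ := (hA.eigenvectorUnitary : Matrix n n ℂ) with hUdef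
  have hUmem := (hA.eigenvectorUnitary).2
  have hU1 : star U * U = 1 := Unitary.star_mul_self_of_mem hUmem
  have hU2 : U * star U = 1 := Unitary.mul_star_self_of_mem hUmem
  have hspec : A = U * diagonal (RCLike.ofReal ∘ hA.eigenvalues) * star U := hA.spectral_theorem
  set w : n → ℂ := star U *ᵥ v with hw
  have hw1 : ∑ i, ‖w i‖ ^ 2 = 1 := by
    rw [hw, sum_norm_sq_mulVec_of_isometry (by simpa [Matrix.star_eq_conjTranspose] using hU2), hv1]
  have hAv : A *ᵥ v = U *ᵥ (diagonal (RCLike.ofReal ∘ hA.eigenvalues) *ᵥ w) := by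
    rw [hw, mulVec_mulVec, mulVec_mulVec, ← hspec]
  have hsum : ∑ i, ‖(A *ᵥ v) i‖ ^ 2 =
      ∑ i, ‖((RCLike.ofReal ∘ hA.eigenvalues) i : ℂ)‖ ^ 2 * ‖w i‖ ^ 2 := by
    rw [hAv, sum_norm_sq_mulVec_of_isometry (by simpa [Matrix.star_eq_conjTranspose] using hU1),
      sum_norm_sq_diagonal_mulVec]
  have hge : ε ^ 2 ≤ ∑ i, ‖((RCLike.ofReal ∘ hA.eigenvalues) i : ℂ)‖ ^ 2 * ‖w i‖ ^ 2 := by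
    calc ε ^ 2 = ∑ i, ε ^ 2 * ‖w i‖ ^ 2 := by rw [← Finset.mul_sum, hw1, mul_one]
      _ ≤ _ := Finset.sum_le_sum fun i _ => by
          refine mul_le_mul_of_nonneg_right ?_ (by positivity)
          have h1 : ‖((RCLike.ofReal ∘ hA.eigenvalues) i : ℂ)‖ = |hA.eigenvalues i| := by
            simp
          rw [h1]
          exact pow_le_pow_left₀ hε (hlam i) 2
  rw [hsum] at hv
  linarith

/-- The `Γ₅`-lift is an entrywise sign: it preserves the `ℓ²` sum. [folklore] -/
theorem sum_norm_sq_spinorLift_gammaFive_mulVec {L : ℕ} [NeZero L] (w : QuarkIdx L → ℂ) :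
    ∑ i, ‖((spinorLift gammaFive : Matrix (QuarkIdx L) (QuarkIdx L) ℂ) *ᵥ w) i‖ ^ 2 =
      ∑ i, ‖w i‖ ^ 2 := by
  rw [spinorLift_gammaFive_eq_diagonal]
  refine Finset.sum_congr rfl fun i _ => ?_
  rw [mulVec_diagonal, norm_mul]
  obtain ⟨x, a, α⟩ := i
  fin_cases α <;> simp

/-- **Singular-value criterion (converse direction).**  A unit spinor `v` with
`‖D_W(U,m₀,1) v‖ < ε` forces `N(ε; U, m₀) ≥ 1` — the entry point for LOWER bounds on the window
count (toron modes: at `U = 1` the constant spinors have `D_W(1,m₀,1)v = m₀ v`, so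
`N(ε; 1, m₀) ≥ 1` for `ε > |m₀|`; defect modes).  A rigorous lower bound on `E N` needs in addition
the a.e.-strong measurability of the count in `U` (it is Borel: lower semicontinuous) and a lower
bound on the Wilson measure of a neighbourhood — neither formalised. [folklore] -/
theorem window_pos_of_small_image {L : ℕ} [NeZero L] (U : GaugeConfig 4 L SU3) {m₀ ε : ℝ}
    (hε : 0 ≤ ε) (v : QuarkIdx L → ℂ) (hv1 : ∑ i, ‖v i‖ ^ 2 = 1)
    (hv : ∑ i, ‖(wilsonDirac (fundamentalRep (Fin 3)) U m₀ 1 *ᵥ v) i‖ ^ 2 < ε ^ 2) :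
    0 < Multiset.countP (fun z : ℂ => |z.re| < ε)
      (spinorLift gammaFive * wilsonDirac (fundamentalRep (Fin 3)) U m₀ 1).charpoly.roots := by
  have hρ : ∀ g, fundamentalRep (Fin 3) g ∈ Matrix.unitaryGroup (Fin 3) ℂ :=
    fundamentalRep_mem_unitaryGroup
  have hH := isHermitian_gammaFive_mul_wilsonDirac _ hρ U m₀ 1
  refine countP_pos_of_small_image hH hε v hv1 ?_
  rwa [← mulVec_mulVec, sum_norm_sq_spinorLift_gammaFive_mulVec]

end Converse

/-! ### The trivial configuration: constant modes, `N(ε; 1, m₀) ≥ 1` for `ε > |m₀|` -/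

section FreeToron

/-- Forward hop of a constant field at `U = 1`, generic spin matrix `T`. [folklore] -/
theorem sum_fwd_const {L : ℕ} [NeZero L] (p : QuarkIdx L) (μ : Fin 4)
    (T : Matrix (Fin 4) (Fin 4) ℂ) (c : Fin 3 × Fin 4 → ℂ) (k : ℂ) :
    ∑ q : QuarkIdx L, (if q.1 = Site.shift p.1 μ then
        k * (T p.2.2 q.2.2 * (1 : Matrix (Fin 3) (Fin 3) ℂ) p.2.1 q.2.1) * c q.2 else 0)
      = k * ∑ β, T p.2.2 β * c (p.2.1, β) := by
  rw [Fintype.sum_prod_type]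
  simp only [Finset.sum_ite_irrel, Finset.sum_const_zero, Finset.sum_ite_eq', Finset.mem_univ,
    if_true]
  rw [Fintype.sum_prod_type]
  simp only [Matrix.one_apply, mul_ite, mul_one, mul_zero, ite_mul, zero_mul]
  rw [Finset.sum_comm]
  simp only [Finset.sum_ite_eq, Finset.mem_univ, if_true, Finset.mul_sum]
  refine Finset.sum_congr rfl fun β _ => ?_
  ring

/-- Backward hop of a constant field at `U = 1`, generic spin matrix `T`. [folklore] -/
theorem sum_bwd_const {L : ℕ} [NeZero L] (p : QuarkIdx L) (μ : Fin 4)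
    (T : Matrix (Fin 4) (Fin 4) ℂ) (c : Fin 3 × Fin 4 → ℂ) (k : ℂ) :
    ∑ q : QuarkIdx L, (if p.1 = Site.shift q.1 μ then
        k * (T p.2.2 q.2.2 * (1 : Matrix (Fin 3) (Fin 3) ℂ) p.2.1 q.2.1) * c q.2 else 0)
      = k * ∑ β, T p.2.2 β * c (p.2.1, β) := by
  simp only [eq_shift_iff]
  rw [Fintype.sum_prod_type]
  simp only [Finset.sum_ite_irrel, Finset.sum_const_zero, Finset.sum_ite_eq', Finset.mem_univ,
    if_true]
  rw [Fintype.sum_prod_type]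
  simp only [Matrix.one_apply, mul_ite, mul_one, mul_zero, ite_mul, zero_mul]
  rw [Finset.sum_comm]
  simp only [Finset.sum_ite_eq, Finset.mem_univ, if_true, Finset.mul_sum]
  refine Finset.sum_congr rfl fun β _ => ?_
  ring

/-- At the trivial gauge field the constant colour–spinors are eigenvectors of `D_W(1, m₀, 1)` with
eigenvalue `m₀` (the 12 zero-momentum modes; the `γ_μ` parts of the two hops cancel and the Wilson
parts give `-4`). [folklore] -/
theorem wilsonDirac_one_mulVec_const {L : ℕ} [NeZero L] (m₀ : ℝ) (c : Fin 3 × Fin 4 → ℂ) :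
    wilsonDirac (fundamentalRep (Fin 3)) (1 : GaugeConfig 4 L SU3) m₀ 1 *ᵥ (fun p => c p.2) =
      fun p => (m₀ : ℂ) * c p.2 := by
  funext p
  rw [mulVec, dotProduct]
  simp only [wilsonDirac, Matrix.of_apply, Pi.one_apply, map_one, inv_one, sub_mul,
    Finset.sum_sub_distrib, ite_mul, zero_mul, Finset.sum_ite_eq, Finset.mem_univ, if_true]
  simp only [Finset.mul_sum, Finset.sum_mul, mul_add, add_mul, Finset.sum_add_distrib, ite_mul,
    zero_mul, mul_ite, mul_zero]
  rw [Finset.sum_comm (s := (Finset.univ : Finset (QuarkIdx L))) (t := (Finset.univ : Finset (Fin 4))),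
    Finset.sum_comm (s := (Finset.univ : Finset (QuarkIdx L))) (t := (Finset.univ : Finset (Fin 4)))]
  simp only [sum_fwd_const, sum_bwd_const]
  have hT : ∀ μ β, ((((1 : ℝ) : ℂ) • (1 : Matrix (Fin 4) (Fin 4) ℂ) - euclideanGamma μ) p.2.2 β) * c (p.2.1, β) +
      ((((1 : ℝ) : ℂ) • (1 : Matrix (Fin 4) (Fin 4) ℂ) + euclideanGamma μ) p.2.2 β) * c (p.2.1, β) =
      2 * ((1 : Matrix (Fin 4) (Fin 4) ℂ) p.2.2 β * c (p.2.1, β)) := by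
    intro μ β
    simp only [Matrix.sub_apply, Matrix.add_apply, Matrix.smul_apply, smul_eq_mul, Complex.ofReal_one,
      one_mul]
    ring
  rw [← Finset.sum_add_distrib]
  simp_rw [← mul_add, ← Finset.sum_add_distrib, hT, ← Finset.mul_sum]
  simp only [Matrix.one_apply, ite_mul, one_mul, zero_mul, Finset.sum_ite_eq, Finset.mem_univ,
    if_true, Finset.sum_const, Finset.card_univ, Fintype.card_fin, nsmul_eq_mul]
  push_cast
  ring

/-- **Free toron modes are window modes.**  At the trivial gauge field, for every bare mass `m₀` and
every `ε > |m₀|`, `γ₅ D_W(1, m₀, 1)` has an eigenvalue in `(-ε, ε)`: `N(ε; 1, m₀) ≥ 1` on every torus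
`L ≥ 1` (indeed `= 12` for small `ε`; by gauge invariance the same holds on the whole pure-gauge
orbit, and by continuity on a neighbourhood of it — the configurations the toron floor is about).
[folklore] -/
theorem window_one_pos {L : ℕ} [NeZero L] {m₀ ε : ℝ} (h : |m₀| < ε) :
    0 < Multiset.countP (fun z : ℂ => |z.re| < ε)
      (spinorLift gammaFive *
        wilsonDirac (fundamentalRep (Fin 3)) (1 : GaugeConfig 4 L SU3) m₀ 1).charpoly.roots := by
  obtain ⟨hlo, hhi⟩ := abs_lt.1 h
  set c : Fin 3 × Fin 4 → ℂ := fun s => if s = (0, 0) then 1 else 0 with hc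
  set S : ℝ := ∑ p : QuarkIdx L, ‖c p.2‖ ^ 2 with hS
  have hS1 : 1 ≤ S := by
    have := Finset.single_le_sum (f := fun p : QuarkIdx L => ‖c p.2‖ ^ 2) (fun p _ => by positivity)
      (Finset.mem_univ ((0 : TorusSite 4 L), (0 : Fin 3), (0 : Fin 4)))
    simpa [hc] using this
  have hSpos : 0 < S := by linarith
  set r : ℝ := (Real.sqrt S)⁻¹ with hr
  have hr2 : r ^ 2 * S = 1 := by
    rw [hr, inv_pow, Real.sq_sqrt hSpos.le, inv_mul_cancel₀ hSpos.ne']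
  set v : QuarkIdx L → ℂ := fun p => (r : ℂ) * c p.2 with hv
  have hv1 : ∑ p, ‖v p‖ ^ 2 = 1 := by
    simp only [hv, norm_mul, mul_pow, Complex.norm_real, Real.norm_eq_abs, sq_abs]
    rw [← Finset.mul_sum]
    exact hr2
  have hDv : wilsonDirac (fundamentalRep (Fin 3)) (1 : GaugeConfig 4 L SU3) m₀ 1 *ᵥ v =
      fun p => (m₀ : ℂ) * v p :=
    wilsonDirac_one_mulVec_const (L := L) m₀ (fun s => (r : ℂ) * c s)
  refine window_pos_of_small_image (1 : GaugeConfig 4 L SU3) ((abs_nonneg m₀).trans h.le) v hv1 ?_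
  rw [hDv]
  simp only [norm_mul, mul_pow, Complex.norm_real, Real.norm_eq_abs, sq_abs]
  rw [← Finset.mul_sum, hv1, mul_one]
  exact sq_lt_sq' hlo hhi

end FreeToron

/-! ## Gauge invariance of the window count; window modes on the whole pure-gauge orbit -/

/-- The spin matrix `Γ₅`-lift commutes with colour gauge rotations. [folklore] -/
theorem spinorLift_gammaFive_mul_gaugeRotation {L : ℕ} [NeZero L] {G : Type*} [Group G]
    (ρ : G →* Matrix (Fin 3) (Fin 3) ℂ) (g : TorusSite 4 L → G) :
    (spinorLift gammaFive : Matrix (TorusSite 4 L × Fin 3 × Fin 4) _ ℂ) * gaugeRotation ρ (Fin 4) g =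
      gaugeRotation ρ (Fin 4) g * spinorLift gammaFive := by
  rw [spinorLift_gammaFive_eq_diagonal]
  ext p q
  rw [diagonal_mul, mul_diagonal]
  simp only [gaugeRotation, Matrix.of_apply, Matrix.one_apply]
  by_cases h : p.2.2 = q.2.2
  · rw [h, mul_comm]
  · simp [h]

/-- **Gauge covariance of the Hermitian Wilson–Dirac operator**: `γ₅D_W(U^g) = 𝒢(g) γ₅D_W(U) 𝒢(g)⁻¹`
(tree `wilsonDirac_gaugeTransform` and `[Γ₅, 𝒢] = 0`). [folklore] -/
theorem hermitianWilsonDirac_gaugeTransform {L : ℕ} [NeZero L] {G : Type*} [Group G]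
    (ρ : G →* Matrix (Fin 3) (Fin 3) ℂ) (g : TorusSite 4 L → G) (U : GaugeConfig 4 L G) (m r : ℝ) :
    spinorLift gammaFive * wilsonDirac ρ (gaugeTransform g U) m r =
      gaugeRotation ρ (Fin 4) g * (spinorLift gammaFive * wilsonDirac ρ U m r) *
        gaugeRotation ρ (Fin 4) g⁻¹ := by
  rw [wilsonDirac_gaugeTransform, ← Matrix.mul_assoc, ← Matrix.mul_assoc,
    spinorLift_gammaFive_mul_gaugeRotation]
  simp only [Matrix.mul_assoc]

/-- **The characteristic polynomial of `γ₅D_W` — hence every window count — is gauge invariant.**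
[folklore] -/
theorem charpoly_hermitianWilsonDirac_gaugeTransform {L : ℕ} [NeZero L] {G : Type*} [Group G]
    (ρ : G →* Matrix (Fin 3) (Fin 3) ℂ) (g : TorusSite 4 L → G) (U : GaugeConfig 4 L G) (m r : ℝ) :
    (spinorLift gammaFive * wilsonDirac ρ (gaugeTransform g U) m r).charpoly =
      (spinorLift gammaFive * wilsonDirac ρ U m r).charpoly := by
  rw [hermitianWilsonDirac_gaugeTransform, Matrix.mul_assoc, Matrix.charpoly_mul_comm,
    Matrix.mul_assoc, gaugeRotation_inv_mul, Matrix.mul_one]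

/-- **Window modes on the whole pure-gauge orbit**: for every gauge function `g`, the pure gauge
`U = 1^g` carries an eigenvalue of `γ₅D_W(U, m₀, 1)` in `(-ε, ε)` whenever `ε > |m₀|` (sibling
`window_one_pos` transported by gauge invariance).  This is the configuration-wise half of the toron
floor; the measure half (mass of a `β^{-1/4}`-neighbourhood of this orbit under the Wilson measure as
`β → ∞`) is the open part. [folklore] -/
theorem window_pureGauge_pos {L : ℕ} [NeZero L] (g : TorusSite 4 L → SU3) {m₀ ε : ℝ}
    (h : |m₀| < ε) :
    0 < Multiset.countP (fun z : ℂ => |z.re| < ε)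
      (spinorLift gammaFive *
        wilsonDirac (fundamentalRep (Fin 3)) (gaugeTransform g (1 : GaugeConfig 4 L SU3)) m₀ 1
        ).charpoly.roots := by
  rw [charpoly_hermitianWilsonDirac_gaugeTransform]
  exact window_one_pos h




/-! ## (b) Tightness: the polynomial factor in `β` cannot be dropped (modulo the toron floor) -/

/-- The natural STRENGTHENING with a `β`-uniform constant (`p = 0`). -/
def WegnerEstimatePZero : Prop :=
  ∃ C : ℝ, 0 < C ∧ ∀ β : ℝ, 1 ≤ β → ∀ (L : ℕ) [NeZero L], 2 ≤ L →
    ∀ m₀ ε : ℝ, -1 ≤ m₀ → m₀ ≤ 0 → 0 < ε → ε ≤ 1 →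
      expWindowCount β L m₀ ε ≤ C * ε * (L : ℝ) ^ 4

/-- `WegnerEstimatePZero` trivially implies the crux (take `p = 0`, constant `C`). -/
theorem wegnerEstimate_of_pZero (h : WegnerEstimatePZero) : WegnerEstimate := by
  obtain ⟨C, hC, h⟩ := h
  refine ⟨C, 0, hC, le_rfl, fun β hβ L _ hL m₀ ε hm hm' hε hε1 => ?_⟩
  calc expWindowCount β L m₀ ε ≤ C * ε * (L : ℝ) ^ 4 := h β hβ L hL m₀ ε hm hm' hε hε1
    _ ≤ C * (1 + β ^ (0 : ℝ)) * ε * (L : ℝ) ^ 4 := by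
      rw [Real.rpow_zero]
      have : (0 : ℝ) ≤ C * ε * (L : ℝ) ^ 4 := by positivity
      nlinarith

/-- **Toron floor** (the precise analytic input; weakest form that kills `p = 0`): on the `2⁴` torus,
windows of VANISHING width keep an expected eigenvalue count bounded away from zero as `β` ranges
over `[1, ∞)`: `∃ c > 0, ∀ δ > 0, ∃ β ≥ 1, ∃ m₀ ∈ [-1,0], ∃ ε ∈ (0, δ], c ≤ E_{β,2} N(ε; m₀)`.
Mechanism (heuristic, standard toron physics): as `β → ∞` at fixed `L` the Wilson measure of pure
`SU(3)` gauge theory concentrates on flat connections (Laplace), and among those on the `3⁴` centre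
sectors with holonomy angles `|θ| ≲ β^{-1/4}` — the Gaussian weight of the `18 = 3(n-r)` constant
off-Cartan modes, `(β θ²)^{-9}`, beats the orbit-volume (Weyl) factor `θ⁶` and phase space `θ⁷dθ`,
so `∫_{θ_c} θ^{-5} dθ` is dominated by the quartic core `θ_c ≍ β^{-1/4}`; in the trivial sector
(weight `→ 1/81`) the 12 constant modes of `γ₅ D_W(U, 0, 1)` sit at `≈ ±|θ^a|/L`, all other levels
and all other sectors at `≳ 0.86`.  Hence `E_{β,2} N(ε; 0) → 12/81` whenever `β^{-1/4} ≪ ε ≤ 1/2`,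
which is `ToronFloor` with `c = 1/10`, `ε = δ`, `β ≍ δ^{-4}` (and the law `sup_ε E N/ε ≍ β^{1/4}`).
-/
def ToronFloor : Prop :=
  ∃ c : ℝ, 0 < c ∧ ∀ δ : ℝ, 0 < δ → ∃ β : ℝ, 1 ≤ β ∧ ∃ m₀ : ℝ, -1 ≤ m₀ ∧ m₀ ≤ 0 ∧
    ∃ ε : ℝ, 0 < ε ∧ ε ≤ δ ∧ c ≤ expWindowCount β 2 m₀ ε

/-- **The `β`-uniform Wegner estimate is false given the toron floor.**  (`ε ≤ δ ≤ 1` windows with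
expected count `≥ c` against a bound `16 C ε → 0`.) -/
theorem not_wegnerEstimatePZero_of_toronFloor (hT : ToronFloor) : ¬ WegnerEstimatePZero := by
  rintro ⟨C, hC, h⟩
  obtain ⟨c, hc, hT⟩ := hT
  -- choose the width so small that `C * ε * 16 < c`
  obtain ⟨β, hβ, m₀, hm, hm', ε, hε, hεδ, hfloor⟩ := hT (min 1 (c / (32 * C))) (by positivity)
  have hε1 : ε ≤ 1 := hεδ.trans (min_le_left _ _)
  have hεc : ε ≤ c / (32 * C) := hεδ.trans (min_le_right _ _)
  have hb := h β hβ 2 le_rfl m₀ ε hm hm' hε hε1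
  norm_num at hb
  -- hb : expWindowCount β 2 m₀ ε ≤ C * ε * 16
  have hCε : C * ε ≤ c / 32 := by
    calc C * ε ≤ C * (c / (32 * C)) := mul_le_mul_of_nonneg_left hεc hC.le
      _ = c / 32 := by field_simp
  linarith

/-- NEAR-MISS (sorry; the one `sorry` of this file).  The toron floor itself.  Obstruction: needs
Laplace asymptotics of the `SU(3)` Wilson measure on the `2⁴` torus at the SINGULAR stratum `U ∼ 1`
of the flat connections (quartic, not Morse–Bott, in the 32 constant modes), i.e. a quantitative
version of tree `laplace_concentration` (TiltedFlatness/Negative/TwoWellFloor) plus second-order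
perturbation theory of the 12 constant modes of `γ₅ D_W`; neither is in reach this cycle.  Tried:
(i) plain Laplace concentration on the flat set — insufficient, generic flat connections have no
mode below `|θ|/L`; (ii) `m₀`-tuning — at a flat connection `min |spec γ₅D_W(U,m₀)| ≳ min_a |θ^a|/L`
for every `m₀ ∈ [-1,0]`, so the holonomy must be small: the concentration AT SMALL HOLONOMY is the
whole content.  NUMERICAL EVIDENCE (kit job j013777, `2⁴`, exact `Z₃⁴` centre averaging, 120
configurations per `β`; NOTES.md has the table): trivial-sector chain shows exactly 12 low modes of
`γ₅D_W(U,0,1)` (13th at `≈ 1.95–1.98`); their scale follows `β^{-1/4}` — median of the 12th mode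
`0.678, 0.517, 0.343` at `β = 16, 64, 256` (ratios `0.76, 0.66` per factor 4; predicted `0.707`),
Polyakov-phase RMS `0.52, 0.39, 0.24, 0.18` at `β = 16, 64, 256, 1024`; the `Z₃⁴`-averaged
`E N(ε; 0)` saturates at EXACTLY `12/81 = 0.1481` for `ε ∈ [0.5, 0.7]` at `β = 256`; and
`sup_{ε ≤ 0.7} E N(ε;0)/ε = 0.236, 0.247, 0.387` grows like `β^{0.2–0.3}`.  Strong coupling (job
j013765, `β ∈ {1,2,3,6}`, 600 configurations): the spectrum is GAPPED away from `0` for every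
`m₀ ∈ [-1,0]` (1%-quantile of `min|eig|` between `0.25` and `1.3`; `≤ 4` eigenvalues below `0.125` in
`600 × 192`), `E N/(εL⁴)` is maximal at `ε = 1` where `C ≈ 0.5`, `p = 0` suffice. -/
theorem toronFloor : ToronFloor := by
  sorry

/-- Hence, modulo the near-miss: `p = 0` is impossible; any proof of the crux spends `p ≥ 1/4`
(heuristically `sup_{m₀,ε} E_{β,2}N/(16 ε) ≍ 0.01 β^{1/4}`). -/
theorem not_wegnerEstimatePZero : ¬ WegnerEstimatePZero :=
  not_wegnerEstimatePZero_of_toronFloor toronFloor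

/-! ## Briefing for provers (what the disproof attempts say about HOW the crux can be true)

* UPPER bounds need no measurability: if `U ↦ N(ε;U,m₀)` were not a.e.-strongly measurable the
  Bochner integral is `0` and the inequality holds; so a proof may freely work with a measurable
  majorant of `N`.
* `N(ε;U,m₀) = #{σ_j(D_W(U,0,1) + m₀) < ε}` (`hermitianWilsonDirac_mul_self`): an anti-concentration
  statement for small singular values of an AFFINE image of `4L⁴` independent Haar `SU(3)` blocks
  (`D = (m₀+4)·1 - ½Σ_μ (P⁻_μ ⊗ U_μT_μ + P⁺_μ ⊗ (U_μT_μ)ᴴ)`, tree `wilsonDirac_eq_sub_sum_wilsonHop`),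
  uniformly in the real shift `m₀`.  There is NO monotone spectral-averaging parameter: `∂H/∂m₀ = Γ₅`
  is indefinite (`hermitianWilsonDirac_mass_shift`), `∂(DᴴD)/∂m₀ = 2(W + m₀)` is indefinite for
  `m₀ < 0`, and each link enters unitarily (rank-24 non-monotone perturbation; interlacing only gives
  `|N(U) - N(U')| ≤ 24` per changed link).  Nearest rigorous templates (none covers this case):
  Wegner's single-site averaging (monotone, iid potential); Combes–Hislop–Klopp / Hislop–Klopp 2002
  (non-sign-definite single-site potentials: Hölder or `ε|log ε|^d` Wegner bounds via analytic
  vector-field averaging under a covering condition); Erdős–Hasler 2012 (random MAGNETIC `U(1)`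
  phases, d = 2, flux lower bound); Rudelson–Vershynin, JAMS 2014 (invertibility of `D + U`, `U` Haar
  on the FULL unitary group: `P(σ_min ≤ t) ≤ t^c n^C` — here `U` is block-structured and sparse).
  A Hölder bound `ε^α` (any `α < 1`) already serves the route (`wegnerEstimateHolder_of_wegnerEstimate`
  docstring: the extinction exponent loses only `(1-α)/(4b₀)`).
* Regimes.  (i) `m₀ = 0` endpoint: reduces to the IDS at the bottom of the random covariant
  Laplacian (`exists_dirichlet_lt_of_window`; min–max gives `N ≤ 4·#{eig ½Δ_U < ε}`), Lifshitz-tail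
  territory at strong coupling, torons at weak coupling (`p ≥ 1/2` on that route).  (ii) `m₀ < 0`,
  `ε ≪ |m₀|`: pseudospectrum of `D_W(U,0,1)` at the real point `|m₀| ∈ (0,1]` inside the Wilson hole
  — the landing law proper; positivity is silent; the configurations that matter carry BNN-type
  defect modes (large `|m₀|`) or large smooth near-flat patches (small `|m₀|`, cf. crux
  `TipNoBinding`).  (iii) `β → ∞` at fixed `L`: torons force `p ≥ 1/4` and nothing worse
  (`not_wegnerEstimatePZero_of_toronFloor`, `window_one_pos`); all `3⁴ - 1` non-trivial centre
  sectors are gapped (`|λ| ≥ 0.86` on `2⁴` for `m₀ ∈ [-1,0]`).  (iv) `β ∈ [1, 3]` (strong coupling,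
  `β_W ≤ 9`) and `L` large: bounded DOS expected (no 4D van Hove divergence, no chiral symmetry in
  the band: the sublattice-chiral point is `m₀ = -4`); numerics pending (kit jobs in NOTES.md).
* For a LOWER bound / refutation one needs (a) measurability (lower semicontinuity) of the count in
  `U` — e.g. `{N ≥ k}` open via min–max — and (b) a small-ball lower bound for the Wilson measure
  near the pure-gauge orbit with the toron scaling `β^{-1/4}`; (a) lacks Courant–Fischer in Mathlib,
  (b) is the sorry `toronFloor`.
-/

end

end Summit.QuantumFields.QCD.Cruxes.WegnerEstimate.Disproof
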